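import Mathlib
import Summits.ValiantsHypothesis.ValiantsHypothesis.Theorems.ValuativeGCTValuativeFlipFourRowTransfer

/-!
# Four-row tangent rank: converse bound and `m ↔ m'` transfer (crux `ValuativeGCT.ValuativeFlip`)

Second helper file (`--supports stmt-ValiantsHypothesis-12624`) of the transfer axis for line
`four-row-count`, stub `stub_fourRowPencilRank`; lower bound / reduction in
`Theorems/ValuativeGCTValuativeFlipFourRowTransfer.lean`.  Here: every pencil is dominated above the
bottom (`frt_finrank_fourRowSpan_ge_of_lt`, no rank proviso); conversely every `g ∈ GL_{m²}` has
four-row rank `≤ d₀(M_g) + 4` for the pencil `M_g` read off from `g` (`frt_finrank_fourRowSpan_le`);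
hence the attainable four-row rank is stable in `m` up to `4` (`fourRowRank_transfer`, in particular
`m ↔ m + 1`), and the registered stub implies the `m`-free certificate up to `4`
(`pencilBound_of_fourRowPencilRank`): the reduction of the first file loses nothing.
-/

set_option linter.dupNamespace false

namespace Summit.ValiantsHypothesis.ValiantsHypothesis.Theorems.ValuativeFlip

open MvPolynomial Literature.NumberTheory.DiophantineGeometry
open Literature.Computability.AlgebraicComplexity

noncomputable section

/-- The four kept variables (`m² ≤ idx + 4`) of `MatIdx m`, `m ≥ 2`, enumerated injectively by
`Fin 4`. [folklore] -/
theorem frt_exists_kept_enum (m : ℕ) (hm : 2 ≤ m) :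
    ∃ κ : Fin 4 → MatIdx m, Function.Injective κ ∧
      ∀ i : MatIdx m, m * m ≤ (((matIdxEquiv m).symm i : Fin (m * m)) : ℕ) + 4 ↔ i ∈ Set.range κ := by
  have h4 : 4 ≤ m * m := Nat.mul_le_mul hm hm
  refine ⟨fun t => matIdxEquiv m ⟨m * m - 4 + (t : ℕ), by have := t.2; omega⟩, ?_, ?_⟩
  · intro t₁ t₂ h
    have h' := congr_arg (fun i => (((matIdxEquiv m).symm i : Fin (m * m)) : ℕ)) h
    simp only [OrderIso.symm_apply_apply] at h'
    exact Fin.ext (by omega)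
  · intro i
    constructor
    · intro hi
      have hlt := ((matIdxEquiv m).symm i).2
      refine ⟨⟨(((matIdxEquiv m).symm i : Fin (m * m)) : ℕ) + 4 - m * m, by omega⟩, ?_⟩
      simp only
      conv_rhs => rw [← (matIdxEquiv m).apply_symm_apply i]
      congr 1
      exact Fin.ext (by simp only; omega)
    · rintro ⟨t, rfl⟩
      simp only [OrderIso.symm_apply_apply]
      omega

/-- The block cells of the padded permanent, enumerated injectively by `Fin n × Fin n`: both
coordinates are `≥ m - n`, and `paddedPerFormLex ℂ n m = X₀₀^(m-n) · per_n(X_E)`. [folklore] -/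
theorem frt_exists_block_enum (n m : ℕ) [NeZero m] (hnm : n ≤ m) :
    ∃ E : Fin n × Fin n → MatIdx m, Function.Injective E ∧
      (∀ ij, m - n ≤ ((ofLex (E ij)).1 : ℕ) ∧ m - n ≤ ((ofLex (E ij)).2 : ℕ)) ∧
      paddedPerFormLex ℂ n m = (X (toLex ((0 : Fin m), (0 : Fin m))) : MvPolynomial (MatIdx m) ℂ) ^ (m - n) *
        rename E (perPoly (Fin n) ℂ) := by
  let σ' : Fin n ≃ BlockIdx n m := (Fintype.equivFinOfCardEq (card_blockIdx hnm)).symm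
  refine ⟨fun ij => toLex (((σ' ij.1 : BlockIdx n m) : Fin m), ((σ' ij.2 : BlockIdx n m) : Fin m)),
    ?_, ?_, frt_paddedPerFormLex_eq n m σ'⟩
  · intro x y h
    have h1 := congr_arg (fun z : MatIdx m => (ofLex z).1) h
    have h2 := congr_arg (fun z : MatIdx m => (ofLex z).2) h
    simp only [ofLex_toLex] at h1 h2
    exact Prod.ext (σ'.injective (Subtype.ext h1)) (σ'.injective (Subtype.ext h2))
  · intro ij
    simp only [ofLex_toLex]
    exact ⟨(σ' ij.1).2, (σ' ij.2).2⟩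

/-- **Every pencil is dominated above the bottom.** For `n < m`, `3 ≤ m` and ANY pencil `M` (no
rank proviso) some `g ∈ GL_{m²}` has four-row span of dimension `≥ dim span{y_t (∂_{ij} per_n)(M(y))}`:
realise `M` on the block, `y₀` on the padding variable, `y₀..y₃` on the spare cells
`(0,1), (0,2), (1,0), (2,0)`, then argue as in `frt_finrank_fourRowSpan_ge`. [folklore] -/
theorem frt_finrank_fourRowSpan_ge_of_lt (n m : ℕ) [NeZero m] (hnm : n < m) (hm : 3 ≤ m)
    (M : Fin n × Fin n → Fin 4 → ℂ) :
    ∃ g : GL (MatIdx m) ℂ,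
      Module.finrank ℂ ↥(Submodule.span ℂ (Set.range fun tc : Fin 4 × (Fin n × Fin n) => (X tc.1 : MvPolynomial (Fin 4) ℂ) * aeval (fun ij : Fin n × Fin n => ∑ t : Fin 4, M ij t • (X t : MvPolynomial (Fin 4) ℂ)) (pderiv tc.2 (perPoly (Fin n) ℂ)))) ≤
      Module.finrank ℂ ↥(Submodule.span ℂ (Set.range fun ab : {a : MatIdx m // m * m ≤ (((matIdxEquiv m).symm a : Fin (m * m)) : ℕ) + 4} × MatIdx m => (MvPolynomial.X ab.1.1 : MvPolynomial (MatIdx m) ℂ) * MvPolynomial.aeval (fun i : MatIdx m => if m * m ≤ (((matIdxEquiv m).symm i : Fin (m * m)) : ℕ) + 4 then (MvPolynomial.X i : MvPolynomial (MatIdx m) ℂ) else 0) (MvPolynomial.pderiv ab.2 (linSubst (MatIdx m) ℂ ((g : GL (MatIdx m) ℂ) : Matrix (MatIdx m) (MatIdx m) ℂ) (paddedPerFormLex ℂ n m))))) := by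
  classical
  obtain ⟨κ, hκ, hkept⟩ := frt_exists_kept_enum m (by omega)
  obtain ⟨E, hE, hEblk, hf⟩ := frt_exists_block_enum n m hnm.le
  set o : MatIdx m := toLex ((0 : Fin m), (0 : Fin m)) with ho
  have hEo : ∀ ij, E ij ≠ o := fun ij h => by
    have h1 := (hEblk ij).1; rw [h, ho, ofLex_toLex, Fin.val_zero] at h1; omega
  -- four spare cells
  let sp : Fin 4 → MatIdx m := ![toLex ((0 : Fin m), ⟨1, by omega⟩), toLex ((0 : Fin m), ⟨2, by omega⟩),
    toLex ((⟨1, by omega⟩ : Fin m), (0 : Fin m)), toLex ((⟨2, by omega⟩ : Fin m), (0 : Fin m))]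
  have hsp0 : ∀ t, ((ofLex (sp t)).1 : ℕ) = 0 ∨ ((ofLex (sp t)).2 : ℕ) = 0 := by
    intro t; fin_cases t <;> simp [sp]
  have hspE : ∀ t ij, E ij ≠ sp t := by
    intro t ij h
    have h1 := hEblk ij
    rw [h] at h1
    rcases hsp0 t with h0 | h0 <;> omega
  have hspo : ∀ t, sp t ≠ o := by
    intro t h
    have h1 := congr_arg (fun z : MatIdx m => (((ofLex z).1 : ℕ), ((ofLex z).2 : ℕ))) h
    fin_cases t <;> simp [sp, ho] at h1
  have hspinj : Function.Injective sp := by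
    intro t₁ t₂ h
    have h1 := congr_arg (fun z : MatIdx m => (((ofLex z).1 : ℕ), ((ofLex z).2 : ℕ))) h
    fin_cases t₁ <;> fin_cases t₂ <;> simp [sp] at h1 ⊢
  set per : MvPolynomial (Fin n × Fin n) ℂ := perPoly (Fin n) ℂ with hper
  set f : MvPolynomial (MatIdx m) ℂ := paddedPerFormLex ℂ n m with hfdef
  -- the prescribed rows and the realising `g`
  let w : MatIdx m → Fin 4 → ℂ := fun i =>
    if h : ∃ ij, E ij = i then M h.choose else if i = o then Pi.single 0 1 else
      if h' : ∃ t, sp t = i then Pi.single h'.choose 1 else 0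
  have hwE : ∀ ij, w (E ij) = M ij := by
    intro ij
    have h : ∃ ij', E ij' = E ij := ⟨ij, rfl⟩
    simp only [w, dif_pos h]
    rw [hE h.choose_spec]
  have hwo : w o = Pi.single 0 1 := by
    have h : ¬∃ ij, E ij = o := fun ⟨ij, hij⟩ => hEo ij hij
    simp only [w, dif_neg h, if_true]
  have hwsp : ∀ t, w (sp t) = Pi.single t 1 := by
    intro t
    have h : ¬∃ ij, E ij = sp t := fun ⟨ij, hij⟩ => hspE t ij hij
    have h' : ∃ t', sp t' = sp t := ⟨t, rfl⟩
    simp only [w, dif_neg h, if_neg (hspo t), dif_pos h']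
    rw [hspinj h'.choose_spec]
  have hc' : IsUnit (Matrix.of fun t t' : Fin 4 => w (sp t') t) := by
    have : (Matrix.of fun t t' : Fin 4 => w (sp t') t) = 1 := by
      ext t t'
      simp only [Matrix.of_apply, hwsp, Pi.single_apply, Matrix.one_apply]
    rw [this]
    exact isUnit_one
  obtain ⟨g, hg⟩ := frt_exists_gl_of_rows κ hκ w sp hc'
  refine ⟨g, ?_⟩
  -- the restriction `R₄` to the kept variables and `ψ = R₄ ∘ (g · )`
  set R4 : MatIdx m → MvPolynomial (MatIdx m) ℂ := fun i : MatIdx m =>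
    if m * m ≤ (((matIdxEquiv m).symm i : Fin (m * m)) : ℕ) + 4 then
      (MvPolynomial.X i : MvPolynomial (MatIdx m) ℂ) else 0 with hR4
  let ψ : MvPolynomial (MatIdx m) ℂ →ₐ[ℂ] MvPolynomial (MatIdx m) ℂ :=
    (aeval R4).comp (linSubst (MatIdx m) ℂ (g : Matrix (MatIdx m) (MatIdx m) ℂ))
  have hfilter : (Finset.univ.filter fun j : MatIdx m =>
      m * m ≤ (((matIdxEquiv m).symm j : Fin (m * m)) : ℕ) + 4) = Finset.univ.map ⟨κ, hκ⟩ := by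
    ext j
    simp only [Finset.mem_filter, Finset.mem_univ, true_and, Finset.mem_map,
      Function.Embedding.coeFn_mk, hkept, Set.mem_range]
  have hψX : ∀ i, ψ (X i) = rename κ (∑ t, w i t • X t) := by
    intro i
    simp only [ψ, AlgHom.comp_apply, linSubst_X, map_sum, map_smul, aeval_X, rename_X, ← hg]
    have h1 : ∑ j, (g : Matrix (MatIdx m) (MatIdx m) ℂ) j i • R4 j =
        ∑ j ∈ Finset.univ.filter (fun j : MatIdx m =>
          m * m ≤ (((matIdxEquiv m).symm j : Fin (m * m)) : ℕ) + 4),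
          (g : Matrix (MatIdx m) (MatIdx m) ℂ) j i • (X j : MvPolynomial (MatIdx m) ℂ) := by
      rw [Finset.sum_filter]
      exact Finset.sum_congr rfl fun j _ => by simp only [hR4]; split_ifs <;> simp
    rw [h1, hfilter, Finset.sum_map]
    rfl
  set φM : Fin n × Fin n → MvPolynomial (Fin 4) ℂ := fun ij : Fin n × Fin n =>
    ∑ t : Fin 4, M ij t • (X t : MvPolynomial (Fin 4) ℂ) with hφM
  have hψE : ψ.comp (rename E) = (rename κ).comp (aeval φM) :=
    MvPolynomial.algHom_ext fun ij => by
      simp only [AlgHom.comp_apply, rename_X, hψX, hwE, aeval_X, hφM]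
  have hψo : ψ (X o ^ (m - n)) = X (κ 0) ^ (m - n) := by
    rw [map_pow, hψX, hwo]
    simp [Pi.single_apply, Finset.sum_ite_eq', rename_X]
  have hpd : ∀ ij, pderiv (E ij) f = X o ^ (m - n) * rename E (pderiv ij per) := by
    intro ij
    have hz : pderiv (E ij) (X o ^ (m - n) : MvPolynomial (MatIdx m) ℂ) = 0 := by
      rw [Derivation.leibniz_pow, pderiv_X_of_ne (hEo ij).symm, smul_zero, smul_zero]
    rw [hf, Derivation.leibniz, hz, smul_zero, add_zero, pderiv_rename hE, smul_eq_mul]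
  have hψpd : ∀ ij, ψ (pderiv (E ij) f) = X (κ 0) ^ (m - n) * rename κ (aeval φM (pderiv ij per)) := by
    intro ij
    have h1 := AlgHom.congr_fun hψE (pderiv ij per)
    simp only [AlgHom.comp_apply] at h1
    rw [hpd, map_mul, hψo, h1]
  have hchain : ∀ b, aeval R4 (pderiv b (linSubst (MatIdx m) ℂ (g : Matrix (MatIdx m) (MatIdx m) ℂ) f)) =
      ∑ j, (g : Matrix (MatIdx m) (MatIdx m) ℂ) b j • ψ (pderiv j f) := by
    intro b
    rw [pderiv_linSubst_eq_sum, map_sum]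
    simp only [map_smul]
    rfl
  set F : {a : MatIdx m // m * m ≤ (((matIdxEquiv m).symm a : Fin (m * m)) : ℕ) + 4} × MatIdx m →
      MvPolynomial (MatIdx m) ℂ := fun ab =>
    (MvPolynomial.X ab.1.1 : MvPolynomial (MatIdx m) ℂ) * MvPolynomial.aeval R4
      (MvPolynomial.pderiv ab.2 (linSubst (MatIdx m) ℂ ((g : GL (MatIdx m) ℂ) : Matrix (MatIdx m) (MatIdx m) ℂ) f)) with hF
  have hmem : ∀ t ij, X (κ t) * ψ (pderiv (E ij) f) ∈ Submodule.span ℂ (Set.range F) := by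
    intro t ij
    have hκt : m * m ≤ (((matIdxEquiv m).symm (κ t) : Fin (m * m)) : ℕ) + 4 := (hkept _).2 ⟨t, rfl⟩
    have h1 : X (κ t) * ψ (pderiv (E ij) f) ∈
        Submodule.span ℂ (Set.range fun j => X (κ t) * ψ (pderiv j f)) :=
      Submodule.subset_span ⟨E ij, rfl⟩
    rw [← frt_span_range_sum_smul_eq g] at h1
    refine Submodule.span_mono ?_ h1
    rintro _ ⟨b, rfl⟩
    refine ⟨(⟨κ t, hκt⟩, b), ?_⟩
    simp only [hF, hchain b, Finset.mul_sum, mul_smul_comm]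
  let Φ : MvPolynomial (Fin 4) ℂ →ₗ[ℂ] MvPolynomial (MatIdx m) ℂ :=
    LinearMap.mulLeft ℂ (X (κ 0) ^ (m - n)) ∘ₗ (rename κ).toLinearMap
  have hΦ : Function.Injective Φ := by
    intro x y h
    simp only [Φ, LinearMap.coe_comp, Function.comp_apply, AlgHom.toLinearMap_apply,
      LinearMap.mulLeft_apply] at h
    exact rename_injective κ hκ
      (mul_right_injective₀ (pow_ne_zero _ (X_ne_zero (κ 0) : (X (κ 0) : MvPolynomial (MatIdx m) ℂ) ≠ 0)) h)
  have hle : (Submodule.span ℂ (Set.range fun tc : Fin 4 × (Fin n × Fin n) =>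
        (X tc.1 : MvPolynomial (Fin 4) ℂ) * aeval φM (pderiv tc.2 per))).map Φ ≤
      Submodule.span ℂ (Set.range F) := by
    rw [Submodule.map_span, Submodule.span_le]
    rintro _ ⟨_, ⟨⟨t, ij⟩, rfl⟩, rfl⟩
    have h := hmem t ij
    rw [hψpd] at h
    simp only [Φ, LinearMap.coe_comp, Function.comp_apply, AlgHom.toLinearMap_apply, map_mul,
      rename_X, LinearMap.mulLeft_apply, SetLike.mem_coe]
    convert h using 1
    ring
  haveI : Module.Finite ℂ ↥(Submodule.span ℂ (Set.range F)) :=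
    Module.Finite.span_of_finite ℂ (Set.finite_range F)
  exact (LinearEquiv.finrank_eq (Submodule.equivMapOfInjective Φ hΦ _)).trans_le
    (Submodule.finrank_mono hle)

/-- **The converse bound.** For EVERY `g ∈ GL_{m²}` (`n ≤ m`, `2 ≤ m`) the four-row span of
`g · X₀₀^{m-n} per_n` has dimension `≤ dim span{y_t (∂_{ij} per_n)(M_g(y))} + 4` for the pencil `M_g`
read off from `g`: by the chain rule the span is `Σ_t y_t · span_j{(g · ∂_j pp)|₄}`, and `∂_j pp` is
`X₀₀^{m-n}(∂_{ij}per_n)(X_E)` on block cells, `(m-n) X₀₀^{m-n-1} per_n(X_E)` on the padding variable,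
`0` elsewhere, so the span lies in `rename κ (span{y_t ℓ^{m-n-1} per_n(M)} + ℓ^{m-n}·span{…})`.
[folklore; this crux's line four-row-count] -/
theorem frt_finrank_fourRowSpan_le (n m : ℕ) [NeZero m] (hnm : n ≤ m) (hm : 2 ≤ m)
    (g : GL (MatIdx m) ℂ) :
    ∃ M : Fin n × Fin n → Fin 4 → ℂ,
      Module.finrank ℂ ↥(Submodule.span ℂ (Set.range fun ab : {a : MatIdx m // m * m ≤ (((matIdxEquiv m).symm a : Fin (m * m)) : ℕ) + 4} × MatIdx m => (MvPolynomial.X ab.1.1 : MvPolynomial (MatIdx m) ℂ) * MvPolynomial.aeval (fun i : MatIdx m => if m * m ≤ (((matIdxEquiv m).symm i : Fin (m * m)) : ℕ) + 4 then (MvPolynomial.X i : MvPolynomial (MatIdx m) ℂ) else 0) (MvPolynomial.pderiv ab.2 (linSubst (MatIdx m) ℂ ((g : GL (MatIdx m) ℂ) : Matrix (MatIdx m) (MatIdx m) ℂ) (paddedPerFormLex ℂ n m))))) ≤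
      Module.finrank ℂ ↥(Submodule.span ℂ (Set.range fun tc : Fin 4 × (Fin n × Fin n) => (X tc.1 : MvPolynomial (Fin 4) ℂ) * aeval (fun ij : Fin n × Fin n => ∑ t : Fin 4, M ij t • (X t : MvPolynomial (Fin 4) ℂ)) (pderiv tc.2 (perPoly (Fin n) ℂ)))) + 4 := by
  classical
  obtain ⟨κ, hκ, hkept⟩ := frt_exists_kept_enum m hm
  obtain ⟨E, hE, hEblk, hf⟩ := frt_exists_block_enum n m hnm
  set o : MatIdx m := toLex ((0 : Fin m), (0 : Fin m)) with ho
  have hEo : n < m → ∀ ij, E ij ≠ o := fun hlt ij h => by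
    have h1 := (hEblk ij).1; rw [h, ho, ofLex_toLex, Fin.val_zero] at h1; omega
  set per : MvPolynomial (Fin n × Fin n) ℂ := perPoly (Fin n) ℂ with hper
  set f : MvPolynomial (MatIdx m) ℂ := paddedPerFormLex ℂ n m with hfdef
  refine ⟨fun ij t => (g : Matrix (MatIdx m) (MatIdx m) ℂ) (κ t) (E ij), ?_⟩
  set R4 : MatIdx m → MvPolynomial (MatIdx m) ℂ := fun i : MatIdx m =>
    if m * m ≤ (((matIdxEquiv m).symm i : Fin (m * m)) : ℕ) + 4 then
      (MvPolynomial.X i : MvPolynomial (MatIdx m) ℂ) else 0 with hR4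
  let ψ : MvPolynomial (MatIdx m) ℂ →ₐ[ℂ] MvPolynomial (MatIdx m) ℂ :=
    (aeval R4).comp (linSubst (MatIdx m) ℂ (g : Matrix (MatIdx m) (MatIdx m) ℂ))
  have hfilter : (Finset.univ.filter fun j : MatIdx m =>
      m * m ≤ (((matIdxEquiv m).symm j : Fin (m * m)) : ℕ) + 4) = Finset.univ.map ⟨κ, hκ⟩ := by
    ext j
    simp only [Finset.mem_filter, Finset.mem_univ, true_and, Finset.mem_map,
      Function.Embedding.coeFn_mk, hkept, Set.mem_range]
  have hψX : ∀ i, ψ (X i) = rename κ (∑ t, (g : Matrix (MatIdx m) (MatIdx m) ℂ) (κ t) i • X t) := by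
    intro i
    simp only [ψ, AlgHom.comp_apply, linSubst_X, map_sum, map_smul, aeval_X, rename_X]
    have h1 : ∑ j, (g : Matrix (MatIdx m) (MatIdx m) ℂ) j i • R4 j =
        ∑ j ∈ Finset.univ.filter (fun j : MatIdx m =>
          m * m ≤ (((matIdxEquiv m).symm j : Fin (m * m)) : ℕ) + 4),
          (g : Matrix (MatIdx m) (MatIdx m) ℂ) j i • (X j : MvPolynomial (MatIdx m) ℂ) := by
      rw [Finset.sum_filter]
      exact Finset.sum_congr rfl fun j _ => by simp only [hR4]; split_ifs <;> simp
    rw [h1, hfilter, Finset.sum_map]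
    rfl
  set φM : Fin n × Fin n → MvPolynomial (Fin 4) ℂ := fun ij : Fin n × Fin n =>
    ∑ t : Fin 4, (g : Matrix (MatIdx m) (MatIdx m) ℂ) (κ t) (E ij) • (X t : MvPolynomial (Fin 4) ℂ) with hφM
  set ℓ : MvPolynomial (Fin 4) ℂ :=
    ∑ t : Fin 4, (g : Matrix (MatIdx m) (MatIdx m) ℂ) (κ t) o • (X t : MvPolynomial (Fin 4) ℂ) with hℓ
  have hψE : ψ.comp (rename E) = (rename κ).comp (aeval φM) :=
    MvPolynomial.algHom_ext fun ij => by
      simp only [AlgHom.comp_apply, rename_X, hψX, aeval_X, hφM]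
  have hψo : ψ (X o) = rename κ ℓ := by rw [hψX]
  -- classification of `ψ (∂_j f)`
  have hblock : ∀ ij, ψ (pderiv (E ij) f) = rename κ (ℓ ^ (m - n) * aeval φM (pderiv ij per)) := by
    intro ij
    have hz : pderiv (E ij) (X o ^ (m - n) : MvPolynomial (MatIdx m) ℂ) = 0 := by
      by_cases hlt : n < m
      · rw [Derivation.leibniz_pow, pderiv_X_of_ne (hEo hlt ij).symm, smul_zero, smul_zero]
      · have h0 : m - n = 0 := by omega
        rw [h0, pow_zero, Derivation.map_one_eq_zero]
    have h1 := AlgHom.congr_fun hψE (pderiv ij per)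
    simp only [AlgHom.comp_apply] at h1
    rw [hf, Derivation.leibniz, hz, smul_zero, add_zero, pderiv_rename hE, smul_eq_mul, map_mul,
      map_pow, hψo, h1, map_mul, map_pow]
  have hpad : n < m → ψ (pderiv o f) =
      ((m - n : ℕ) : ℂ) • rename κ (ℓ ^ (m - n - 1) * aeval φM per) := by
    intro hlt
    have hz : pderiv o (rename E per) = 0 := by
      refine pderiv_eq_zero_of_notMem_vars (fun ho' => ?_)
      obtain ⟨c, -, hc⟩ := Finset.mem_image.1 (vars_rename E per ho')
      exact hEo hlt c hc
    have h1 := AlgHom.congr_fun hψE per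
    simp only [AlgHom.comp_apply] at h1
    rw [hf, Derivation.leibniz, hz, smul_zero, zero_add, Derivation.leibniz_pow, pderiv_X_self,
      smul_eq_mul, smul_eq_mul, mul_one, map_mul, h1, map_nsmul, map_pow, hψo, map_mul, map_pow,
      nsmul_eq_mul, Algebra.smul_def, map_natCast]
    ring
  have hother : ∀ j, j ∉ Set.range E → (j ≠ o ∨ m - n = 0) → pderiv j f = 0 := by
    intro j hj hjo
    rw [hf]
    refine pderiv_eq_zero_of_notMem_vars (fun hv => ?_)
    rcases Finset.mem_union.1 (vars_mul _ _ hv) with h1 | h1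
    · have h2 := vars_pow _ _ h1
      rcases hjo with hjo | h0
      · rw [vars_X] at h2
        exact hjo (Finset.mem_singleton.1 h2)
      · rw [h0, pow_zero, vars_one] at h1
        -- `vars_pow` was applied to `h1 : j ∈ vars (X o ^ 0)`; redo on the rewritten form
        simp at h1
    · obtain ⟨c, -, hc⟩ := Finset.mem_image.1 (vars_rename E per h1)
      exact hj ⟨c, hc⟩
  -- chain rule
  have hchain : ∀ b, aeval R4 (pderiv b (linSubst (MatIdx m) ℂ (g : Matrix (MatIdx m) (MatIdx m) ℂ) f)) =
      ∑ j, (g : Matrix (MatIdx m) (MatIdx m) ℂ) b j • ψ (pderiv j f) := by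
    intro b
    rw [pderiv_linSubst_eq_sum, map_sum]
    simp only [map_smul]
    rfl
  -- the `m`-free spaces and the target space `W`
  set S1 : Submodule ℂ (MvPolynomial (Fin 4) ℂ) := Submodule.span ℂ (Set.range
    fun tc : Fin 4 × (Fin n × Fin n) => (X tc.1 : MvPolynomial (Fin 4) ℂ) * aeval φM (pderiv tc.2 per)) with hS1
  set A0 : Submodule ℂ (MvPolynomial (Fin 4) ℂ) := Submodule.span ℂ (Set.range
    fun t : Fin 4 => (X t : MvPolynomial (Fin 4) ℂ) * (ℓ ^ (m - n - 1) * aeval φM per)) with hA0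
  set B1 : Submodule ℂ (MvPolynomial (Fin 4) ℂ) := S1.map (LinearMap.mulLeft ℂ (ℓ ^ (m - n))) with hB1
  set W : Submodule ℂ (MvPolynomial (MatIdx m) ℂ) := (A0 ⊔ B1).map (rename κ).toLinearMap with hW
  have hgen : ∀ t j, X (κ t) * ψ (pderiv j f) ∈ W := by
    intro t j
    by_cases hj : j ∈ Set.range E
    · obtain ⟨ij, rfl⟩ := hj
      rw [hblock]
      refine ⟨X t * (ℓ ^ (m - n) * aeval φM (pderiv ij per)), ?_, ?_⟩
      · refine Submodule.mem_sup_right ⟨X t * aeval φM (pderiv ij per),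
          Submodule.subset_span ⟨(t, ij), rfl⟩, ?_⟩
        simp only [LinearMap.mulLeft_apply]
        ring
      · simp only [AlgHom.toLinearMap_apply, map_mul, rename_X]
    · by_cases hjo : j = o
      · rw [hjo]
        by_cases hlt : n < m
        · rw [hpad hlt]
          refine ⟨((m - n : ℕ) : ℂ) • (X t * (ℓ ^ (m - n - 1) * aeval φM per)), ?_, ?_⟩
          · exact Submodule.smul_mem _ _ (Submodule.mem_sup_left (Submodule.subset_span ⟨t, rfl⟩))
          · simp only [AlgHom.toLinearMap_apply, map_smul, map_mul, rename_X, mul_smul_comm]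
        · have h0 : m - n = 0 := by omega
          rw [hother o (hjo ▸ hj) (Or.inr h0), map_zero, mul_zero]
          exact W.zero_mem
      · rw [hother j hj (Or.inl hjo), map_zero, mul_zero]
        exact W.zero_mem
  have hFRSle : Submodule.span ℂ (Set.range fun ab : {a : MatIdx m // m * m ≤ (((matIdxEquiv m).symm a : Fin (m * m)) : ℕ) + 4} × MatIdx m => (MvPolynomial.X ab.1.1 : MvPolynomial (MatIdx m) ℂ) * MvPolynomial.aeval (fun i : MatIdx m => if m * m ≤ (((matIdxEquiv m).symm i : Fin (m * m)) : ℕ) + 4 then (MvPolynomial.X i : MvPolynomial (MatIdx m) ℂ) else 0) (MvPolynomial.pderiv ab.2 (linSubst (MatIdx m) ℂ ((g : GL (MatIdx m) ℂ) : Matrix (MatIdx m) (MatIdx m) ℂ) (paddedPerFormLex ℂ n m)))) ≤ W := by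
    rw [Submodule.span_le]
    rintro _ ⟨⟨⟨a, ha⟩, b⟩, rfl⟩
    obtain ⟨t, rfl⟩ := (hkept a).1 ha
    simp only [SetLike.mem_coe]
    rw [hchain b, Finset.mul_sum]
    exact W.sum_mem fun j _ => by rw [mul_smul_comm]; exact W.smul_mem _ (hgen t j)
  haveI : Module.Finite ℂ ↥S1 := Module.Finite.span_of_finite ℂ (Set.finite_range _)
  haveI : Module.Finite ℂ ↥A0 := Module.Finite.span_of_finite ℂ (Set.finite_range _)
  have hA0le : Module.finrank ℂ ↥A0 ≤ 4 := by
    have h := finrank_range_le_card (R := ℂ)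
      (fun t : Fin 4 => (X t : MvPolynomial (Fin 4) ℂ) * (ℓ ^ (m - n - 1) * aeval φM per))
    rw [Fintype.card_fin] at h
    exact h
  calc Module.finrank ℂ ↥(Submodule.span ℂ (Set.range fun ab : {a : MatIdx m // m * m ≤ (((matIdxEquiv m).symm a : Fin (m * m)) : ℕ) + 4} × MatIdx m => (MvPolynomial.X ab.1.1 : MvPolynomial (MatIdx m) ℂ) * MvPolynomial.aeval (fun i : MatIdx m => if m * m ≤ (((matIdxEquiv m).symm i : Fin (m * m)) : ℕ) + 4 then (MvPolynomial.X i : MvPolynomial (MatIdx m) ℂ) else 0) (MvPolynomial.pderiv ab.2 (linSubst (MatIdx m) ℂ ((g : GL (MatIdx m) ℂ) : Matrix (MatIdx m) (MatIdx m) ℂ) (paddedPerFormLex ℂ n m)))))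
      ≤ Module.finrank ℂ ↥W := Submodule.finrank_mono hFRSle
    _ ≤ Module.finrank ℂ ↥(A0 ⊔ B1) := Submodule.finrank_map_le _ _
    _ ≤ Module.finrank ℂ ↥A0 + Module.finrank ℂ ↥B1 := Submodule.finrank_add_le_finrank_add_finrank _ _
    _ ≤ 4 + Module.finrank ℂ ↥S1 := add_le_add hA0le (Submodule.finrank_map_le _ _)
    _ = Module.finrank ℂ ↥S1 + 4 := add_comm _ _

/-- **Transfer of the four-row rank between levels (`m ↔ m'`, in particular `m ↔ m + 1`).** A rank
`R + 4` attained at a level `m ≥ n` is attained (as `R`) at every level `m' > n`, `m' ≥ 3`: read off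
`M_g` (`frt_finrank_fourRowSpan_le`) and realise it at level `m'` (`frt_finrank_fourRowSpan_ge_of_lt`) —
the per side of the four-row count is stable in the padding parameter `m`. [this line] -/
theorem fourRowRank_transfer (n m m' R : ℕ) [NeZero m] [NeZero m'] (hnm : n ≤ m) (hm : 2 ≤ m)
    (hnm' : n < m') (hm' : 3 ≤ m')
    (h : ∃ g : GL (MatIdx m) ℂ, R + 4 ≤ Module.finrank ℂ ↥(Submodule.span ℂ (Set.range fun ab : {a : MatIdx m // m * m ≤ (((matIdxEquiv m).symm a : Fin (m * m)) : ℕ) + 4} × MatIdx m => (MvPolynomial.X ab.1.1 : MvPolynomial (MatIdx m) ℂ) * MvPolynomial.aeval (fun i : MatIdx m => if m * m ≤ (((matIdxEquiv m).symm i : Fin (m * m)) : ℕ) + 4 then (MvPolynomial.X i : MvPolynomial (MatIdx m) ℂ) else 0) (MvPolynomial.pderiv ab.2 (linSubst (MatIdx m) ℂ ((g : GL (MatIdx m) ℂ) : Matrix (MatIdx m) (MatIdx m) ℂ) (paddedPerFormLex ℂ n m)))))) :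
    ∃ g' : GL (MatIdx m') ℂ, R ≤ Module.finrank ℂ ↥(Submodule.span ℂ (Set.range fun ab : {a : MatIdx m' // m' * m' ≤ (((matIdxEquiv m').symm a : Fin (m' * m')) : ℕ) + 4} × MatIdx m' => (MvPolynomial.X ab.1.1 : MvPolynomial (MatIdx m') ℂ) * MvPolynomial.aeval (fun i : MatIdx m' => if m' * m' ≤ (((matIdxEquiv m').symm i : Fin (m' * m')) : ℕ) + 4 then (MvPolynomial.X i : MvPolynomial (MatIdx m') ℂ) else 0) (MvPolynomial.pderiv ab.2 (linSubst (MatIdx m') ℂ ((g' : GL (MatIdx m') ℂ) : Matrix (MatIdx m') (MatIdx m') ℂ) (paddedPerFormLex ℂ n m'))))) := by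
  obtain ⟨g, hg⟩ := h
  obtain ⟨M, hM⟩ := frt_finrank_fourRowSpan_le n m hnm hm g
  obtain ⟨g', hg'⟩ := frt_finrank_fourRowSpan_ge_of_lt n m' hnm' hm' M
  exact ⟨g', by omega⟩

/-- **Necessity of the `m`-free certificate.** The registered stub `stub_fourRowPencilRank`
(hypothesis, verbatim) gives, for large `n` and every `n ≤ m ≤ (6/5)·n`, a pencil `M` with
`dim span{y_t (∂_{ij} per_n)(M(y))} ≥ 2m² + m - 2`; with `fourRowPencilRank_of_pencilCertificate` the
stub is EQUIVALENT, up to `4` and the rank proviso, to a statement about `per_n` alone. [this line] -/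
theorem pencilBound_of_fourRowPencilRank
    (h : ∃ n₀ : ℕ, ∀ n ≥ n₀, ∀ (m : ℕ) [NeZero m], n ≤ m → 5 * m ≤ 6 * n →
      ∃ g : GL (MatIdx m) ℂ, 2 * m ^ 2 + m + 2 ≤ Module.finrank ℂ ↥(Submodule.span ℂ (Set.range fun ab : {a : MatIdx m // m * m ≤ (((matIdxEquiv m).symm a : Fin (m * m)) : ℕ) + 4} × MatIdx m => (MvPolynomial.X ab.1.1 : MvPolynomial (MatIdx m) ℂ) * MvPolynomial.aeval (fun i : MatIdx m => if m * m ≤ (((matIdxEquiv m).symm i : Fin (m * m)) : ℕ) + 4 then (MvPolynomial.X i : MvPolynomial (MatIdx m) ℂ) else 0) (MvPolynomial.pderiv ab.2 (linSubst (MatIdx m) ℂ ((g : GL (MatIdx m) ℂ) : Matrix (MatIdx m) (MatIdx m) ℂ) (paddedPerFormLex ℂ n m)))))) :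
    ∃ n₀ : ℕ, ∀ n ≥ n₀, ∀ m : ℕ, n ≤ m → 5 * m ≤ 6 * n →
      ∃ M : Fin n × Fin n → Fin 4 → ℂ, 2 * m ^ 2 + m + 2 ≤
        Module.finrank ℂ ↥(Submodule.span ℂ (Set.range fun tc : Fin 4 × (Fin n × Fin n) => (X tc.1 : MvPolynomial (Fin 4) ℂ) * aeval (fun ij : Fin n × Fin n => ∑ t : Fin 4, M ij t • (X t : MvPolynomial (Fin 4) ℂ)) (pderiv tc.2 (perPoly (Fin n) ℂ)))) + 4 := by
  obtain ⟨n₀, hn₀⟩ := h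
  refine ⟨max n₀ 2, fun n hn m hnm h56 => ?_⟩
  have hm : 2 ≤ m := (le_of_max_le_right hn).trans hnm
  haveI : NeZero m := ⟨by omega⟩
  obtain ⟨g, hg⟩ := hn₀ n (le_of_max_le_left hn) m hnm h56
  obtain ⟨M, hM⟩ := frt_finrank_fourRowSpan_le n m hnm hm g
  exact ⟨M, hg.trans hM⟩

end

end Summit.ValiantsHypothesis.ValiantsHypothesis.Theorems.ValuativeFlip
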